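import Mathlib.CategoryTheory.Sites.CoverPreserving
import Mathlib.CategoryTheory.Sites.Pullback
import Literature.AlgebraicGeometry.Motives.ConstantEtaleSheaf
import Literature.AlgebraicGeometry.Motives.EtaleCohomologyPoint
import HarnessLib

/-!
# The morphism of sites `ν : X_proét → X_ét` (Bhatt–Scholze §5) on Mathlib's carriers, and the
# reduction of the pro-étale/étale comparison to Bhatt–Scholze Cor. 5.1.6

Bhatt–Scholze, *The pro-étale topology for schemes*, §5: "Fix a scheme `X`. Since an étale map is
also a weakly étale map, we obtain a morphism of topoi `ν : Shv(X_proét) → Shv(X_ét)`." This file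
builds `ν` between Mathlib's small sites `X.Etale` (`Scheme.smallEtaleTopology`) and `X.ProEt`
(`Scheme.ProEt.topology`) and proves its formal properties:

* `etaleToProet X : X.Etale ⥤ X.ProEt` — the inclusion (`MorphismProperty.Over.changeProp`); it
  preserves finite limits (both forgetful functors to `Over X` do, and `ProEt.forget` reflects
  them), is representably flat, cover preserving (`coverPreserving_etaleToProet`: an étale cover is
  a pro-étale cover, Mathlib `etalePrecoverage_le_proetalePrecoverage`) and hence continuous;
* `proetToEtalePushforward X A = ν_*` (restriction along `etaleToProet`), with
  `ν_* F_A^{proét} = F_A^{ét}` definitionally for the sheaves of continuous maps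
  (`proetToEtalePushforwardContinuousMapIso`);
* `etaleToProetPullback X = ν*` on `Ab.{u+1}`-valued sheaves (Mathlib `Functor.sheafPullback`: left
  Kan extension followed by sheafification) and the adjunction `ν* ⊣ ν_*`
  (`etaleToProetAdjunction`);
* **`ν* ∘ const_ét ≅ const_proét`** (`pullbackConstantSheafIso`, proved): both are left adjoint to
  `Γ(X, –)`, because `Γ(X_ét, ν_* G) = Γ(X_proét, G)` on the nose (`X` is final in both sites and
  `etaleToProet` maps the one final object to the other);
* Milne II 2.18 (a) once more, with coefficients lifted to `Ab.{u+1}` on the étale site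
  (`constantSheafULiftIsoContinuousMapEtSheaf`), needed to move between the coefficient universes
  of the two sides.

With these, the constant-sheaf comparison `Hⁱ(X_proét, M_X) ≅ Hⁱ(X_ét, M_X)` (Cor. 5.1.9 /
Cor. 5.1.6 for constant sheaves), hence the bridge fact
`nonempty_addEquiv_proetCohomology_etaleCohomology` (`EllAdicCohomologyFinitenessEtale.lean`) and —
with Milne VI Cor. 2.8 — `finite_proetCohomology_zmod_of_isProper`, are **reduced to Bhatt–Scholze
Cor. 5.1.6 in its printed, functorial form**, vendored as the named fact

* `nonempty_addEquiv_sheafH_etaleToProetPullback` : for every abelian sheaf `F` on `X_ét`,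
  `Hⁱ(X_ét, F) ≅ Hⁱ(X_proét, ν* F)` (statement only, D-0014),

see `nonempty_addEquiv_constantSheafH_proet_etale_of_pullback` (the constant-sheaf comparison,
stated as an explicit conclusion: it is Cor. 5.1.6 specialised, not a separate named fact — D-0026),
`nonempty_addEquiv_proetCohomology_etaleCohomology_of_pullback`,
`finite_proetCohomology_zmod_of_isProper_of_pullback`.

## References

* B. Bhatt, P. Scholze, *The pro-étale topology for schemes*, Astérisque 369 (2015)
  (arXiv:1309.1198): §5 (the morphism `ν`), Lemma 5.1.1 (`ν*F(U) = colim F(U_i)`), Lemma 5.1.2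
  (`ν*` fully faithful, `F ≃ ν_*ν*F`), Def. 5.1.3, Cor. 5.1.6 ("For any `K ∈ D⁺(X_ét)`, the
  adjunction map `K → ν_*ν*K` is an equivalence"; proof: "it suffices to prove `Hᵖ(U, ν*I) = 0`
  for `I ∈ Ab(X_ét)` injective, `p > 0`, and `U ∈ X_proét^{aff}`", by Čech cohomology of
  ind-étale presentations), Cor. 5.1.9. [BhattScholze2015]
* J. S. Milne, *Étale cohomology*, Princeton (2025 reissue): II Examples 2.18 (a) (held copy
  p. 73), III 1.5 (a), 1.6 (e), VI Cor. 2.8. [Milne2025]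

## Design notes

* Instances are declared only on this file's own functor `etaleToProet X`
  (`PreservesFiniteLimits`, `RepresentablyFlat`, `IsContinuous`), never on Mathlib carriers.
* `ν*` is taken with coefficients `Ab.{u+1}` (the convention of `Scheme.EllAdicCohomology`; the
  left Kan extension along `etaleToProet` needs colimits of size `u+1`); an `Ab.{u}`-valued étale
  sheaf `F` is first lifted by `sheafCompose _ uliftFunctor.{u+1}`. The named fact compares
  `Hⁱ(X_ét, F)` (in `Type u`, Mathlib `HasExt.{u}` via the affine étale site) with
  `Hⁱ(X_proét, ν*(ulift F))` (in `Type (u+1)`); read on these carriers the printed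
  `RΓ(X_ét, K) ≃ RΓ(X_proét, ν*K)` also absorbs the independence of `Hⁱ(X_ét, –)` from the
  coefficient universe. Only the existence of an additive isomorphism is recorded (the canonical
  map needs the exactness of `ν*`, i.e. `PreservesFiniteLimits` of the left Kan extension, which
  Mathlib provides only for small sites).
* Not here (the plan for discharging Cor. 5.1.6, recorded in the session notes): `ν*` is fully
  faithful and exact (Lemma 5.1.2), `Hᵖ(X_proét, ν*I) = 0` for `I` injective (the Čech argument of
  Cor. 5.1.6 over w-contractible / ind-étale covers, Bhatt–Scholze Thm. 2.3.4 and Lemma 5.1.1), and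
  the dimension shifting that turns these into the `Extⁱ(ℤ, –)` comparison (cf. Mathlib
  `Functor.mapExt_bijective_of_preservesInjectiveObjects`).
* Mathlib searches: `MorphismProperty.Over.changeProp`, `Functor.sheafPushforwardContinuous`,
  `Functor.sheafPullback`, `Functor.sheafAdjunctionContinuous`, `constantSheafAdj`,
  `Adjunction.leftAdjointUniq`, `Functor.isContinuous_iff_coverPreserving`; no functor between the
  étale and pro-étale sites of a scheme exists in Mathlib. Nothing restated.
-/

universe u

open CategoryTheory Limits Opposite AlgebraicGeometry

noncomputable section

namespace Literature.AlgebraicGeometry.Motives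

/-! ### The inclusion `X_ét ⥤ X_proét` -/

section Inclusion

variable (X : Scheme.{u})

/-- The inclusion of the small étale site into the small pro-étale site of `X`: an étale
`X`-scheme is a weakly étale `X`-scheme (Bhatt–Scholze §5: "Since an étale map is also a weakly
étale map, we obtain a morphism of topoi `ν`"; Mathlib `MorphismProperty.Over.changeProp`).
[cite: BhattScholze2015, §5] -/
def etaleToProet : X.Etale ⥤ X.ProEt :=
  MorphismProperty.Over.changeProp X (fun _ _ _ _ => inferInstance) le_rfl

/-- `etaleToProet` commutes with the forgetful functors to `Over X` (by `rfl`). [folklore] -/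
theorem etaleToProet_comp_forget :
    etaleToProet X ⋙ Scheme.ProEt.forget X = Scheme.Etale.forget X :=
  rfl

/-- The underlying scheme of `etaleToProet X U` is that of `U` (by `rfl`). [folklore] -/
@[simp] theorem etaleToProet_obj_left (U : X.Etale) : ((etaleToProet X).obj U).left = U.left :=
  rfl

/-- The structure morphism of `etaleToProet X U` is that of `U` (by `rfl`). [folklore] -/
@[simp] theorem etaleToProet_obj_hom (U : X.Etale) : ((etaleToProet X).obj U).hom = U.hom :=
  rfl

/-- `etaleToProet` is the identity on underlying morphisms of schemes (by `rfl`). [folklore] -/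
@[simp] theorem etaleToProet_map_left {U V : X.Etale} (f : U ⟶ V) :
    ((etaleToProet X).map f).left = f.left :=
  rfl

/-- `etaleToProet` preserves finite limits: finite limits in both sites are computed in `Sch/X`
(Bhatt–Scholze Lemma 4.1.8; Mathlib: both forgetful functors to `Over X` preserve finite limits
and the fully faithful `ProEt.forget` reflects them). [cite: BhattScholze2015, Lemma 4.1.8] -/
instance preservesFiniteLimits_etaleToProet : PreservesFiniteLimits (etaleToProet X) := by
  haveI : ReflectsLimitsOfSize.{0, 0} (Scheme.ProEt.forget X) := fullyFaithful_reflectsLimits _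
  haveI : PreservesFiniteLimits (etaleToProet X ⋙ Scheme.ProEt.forget X) :=
    inferInstanceAs (PreservesFiniteLimits (Scheme.Etale.forget X))
  constructor
  intro J _ _
  exact preservesLimitsOfShape_of_reflects_of_preserves (etaleToProet X) (Scheme.ProEt.forget X)

/-- Hence `etaleToProet` is representably flat (`X.Etale` has finite limits). [folklore] -/
instance representablyFlat_etaleToProet : RepresentablyFlat (etaleToProet X) :=
  flat_of_preservesFiniteLimits _

/-- **An étale cover is a pro-étale cover**: `etaleToProet` is cover preserving from the small
étale topology to the pro-étale topology (a covering sieve of `U ∈ X_ét` contains a jointly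
surjective family of étale `X`-morphisms, whose image is a pro-étale covering family; Mathlib
`Scheme.mem_smallGrothendieckTopology`, `etalePrecoverage_le_proetalePrecoverage`).
[cite: BhattScholze2015, §5] -/
theorem coverPreserving_etaleToProet :
    CoverPreserving X.smallEtaleTopology (Scheme.ProEt.topology X) (etaleToProet X) := by
  constructor
  intro U S hS
  obtain ⟨𝒰, h𝒰, h, hle⟩ := (Scheme.mem_smallGrothendieckTopology U S).1 hS
  let T : Presieve ((etaleToProet X).obj U) :=
    Presieve.ofArrows (fun j => (etaleToProet X).obj ((𝒰.X j).asOverProp X (h j)))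
      (fun j => (etaleToProet X).map ((𝒰.f j).asOverProp X))
  have hT : T ∈ Scheme.ProEt.precoverage X ((etaleToProet X).obj U) := by
    rw [Scheme.ProEt.precoverage, Precoverage.mem_comap_iff, Presieve.map_ofArrows]
    exact Scheme.etalePrecoverage_le_proetalePrecoverage _ 𝒰.mem₀
  refine GrothendieckTopology.superset_covering _ ?_ (Precoverage.generate_mem_toGrothendieck hT)
  rw [Sieve.generate_le_iff]
  rintro _ _ ⟨j⟩
  exact Sieve.image_mem_functorPushforward _ _ (hle _ _ ⟨j⟩)

/-- `etaleToProet` is a continuous functor of sites (flat and cover preserving; Mathlib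
`Functor.isContinuous_iff_coverPreserving`), so that restriction along it preserves sheaves.
[cite: BhattScholze2015, §5] -/
instance isContinuous_etaleToProet :
    (etaleToProet X).IsContinuous X.smallEtaleTopology (Scheme.ProEt.topology X) := by
  rw [Functor.isContinuous_iff_coverPreserving]
  exact coverPreserving_etaleToProet X

end Inclusion

/-! ### `ν_*` and `ν*` -/

section Nu

variable (X : Scheme.{u})

/-- **`ν_*`**: the direct image `Shv(X_proét) → Shv(X_ét)`, i.e. restriction of a pro-étale sheaf
to the étale site along the continuous functor `etaleToProet` (Mathlib
`Functor.sheafPushforwardContinuous`). [cite: BhattScholze2015, §5] -/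
abbrev proetToEtalePushforward (A : Type*) [Category A] :
    Sheaf (Scheme.ProEt.topology X) A ⥤ Sheaf X.smallEtaleTopology A :=
  (etaleToProet X).sheafPushforwardContinuous A X.smallEtaleTopology (Scheme.ProEt.topology X)

/-- `ν_*` of the pro-étale sheaf of continuous maps `U ↦ C(U, A)` is the étale sheaf of continuous
maps, for every topological abelian group `A` (both are the restriction of Mathlib's fpqc sheaf
`continuousMapPresheafAb A`; the isomorphism is the identity). For `M` discrete this is the
instance `ν_* F_M = F_M` of Bhatt–Scholze Lemma 5.1.2 (`F ≃ ν_* ν* F`) with Lemma 4.2.12.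
[folklore] -/
def proetToEtalePushforwardContinuousMapIso (A : Type) [TopologicalSpace A] [AddCommGroup A]
    [IsTopologicalAddGroup A] :
    (proetToEtalePushforward X Ab.{u}).obj (continuousMapProetSheaf X A) ≅
      continuousMapEtSheaf X A :=
  Iso.refl _

/-- **`ν*`**: the inverse image `Shv(X_ét, Ab) → Shv(X_proét, Ab)` on `Ab.{u+1}`-valued sheaves,
the left adjoint of `ν_*` (Mathlib `Functor.sheafPullback`: left Kan extension along
`etaleToProet` followed by sheafification; Bhatt–Scholze Lemma 5.1.1 computes its sections on
affines as `ν*F(U) = colim F(U_i)`). [cite: BhattScholze2015, §5 and Lemma 5.1.1] -/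
abbrev etaleToProetPullback :
    Sheaf X.smallEtaleTopology Ab.{u + 1} ⥤ Sheaf (Scheme.ProEt.topology X) Ab.{u + 1} :=
  (etaleToProet X).sheafPullback Ab.{u + 1} X.smallEtaleTopology (Scheme.ProEt.topology X)

/-- The adjunction `ν* ⊣ ν_*` (Mathlib `Functor.sheafAdjunctionContinuous`).
[cite: BhattScholze2015, §5] -/
def etaleToProetAdjunction :
    etaleToProetPullback X ⊣ proetToEtalePushforward X Ab.{u + 1} :=
  (etaleToProet X).sheafAdjunctionContinuous Ab.{u + 1} X.smallEtaleTopology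
    (Scheme.ProEt.topology X)

/-- `Γ(X_ét, ν_* G) = Γ(X_proét, G)`: composing `ν_*` with sections at the final object `𝟙 X` of
`X_ét` (`Scheme.Etale.mk (𝟙 X)`, final by `isTerminalEtaleMkId`) *is* sections at the final
object `Scheme.ProEt.mk (𝟙 X)` of `X_proét` — `etaleToProet` maps the one to the other on the
nose, and the isomorphism is the identity. [folklore] -/
def proetToEtalePushforwardCompSectionsIso :
    proetToEtalePushforward X Ab.{u + 1} ⋙
        (sheafSections X.smallEtaleTopology Ab.{u + 1}).obj (op (Scheme.Etale.mk (𝟙 X))) ≅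
      (sheafSections (Scheme.ProEt.topology X) Ab.{u + 1}).obj (op (Scheme.ProEt.mk (𝟙 X))) :=
  Iso.refl _

/-- **`ν* ∘ const_ét ≅ const_proét`, proved**: the inverse image of a constant étale sheaf is the
constant pro-étale sheaf with the same value. Both `constantSheaf _ ⋙ ν*` and `constantSheaf _`
are left adjoint to the global sections functor `Γ(X_proét, –)` — the former by composing
Mathlib's `constantSheafAdj` (at the final object `X` of `X_ét`, `isTerminalEtaleMkId`) with
`ν* ⊣ ν_*` and using `Γ(X_ét, ν_* –) = Γ(X_proét, –)`, the latter by `constantSheafAdj` at the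
final object of `X_proét` (`proEtTerminal`) — so they agree (`Adjunction.leftAdjointUniq`). This is the compatibility used to read
Bhatt–Scholze Cor. 5.1.9 on `Extⁱ(ℤ, –) = Hⁱ`. [cite: BhattScholze2015, Cor. 5.1.9] -/
def pullbackConstantSheafIso :
    constantSheaf X.smallEtaleTopology Ab.{u + 1} ⋙ etaleToProetPullback X ≅
      constantSheaf (Scheme.ProEt.topology X) Ab.{u + 1} :=
  Adjunction.leftAdjointUniq
    (((constantSheafAdj X.smallEtaleTopology Ab.{u + 1} (isTerminalEtaleMkId X)).comp
      (etaleToProetAdjunction X)).ofNatIsoRight (proetToEtalePushforwardCompSectionsIso X))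
    (constantSheafAdj (Scheme.ProEt.topology X) Ab.{u + 1} (proEtTerminal X))

end Nu

/-! ### Milne II 2.18 (a) with coefficients lifted to `Ab.{u+1}` on the étale site -/

section ConstantULift

variable (X : Scheme.{u}) (M : Type) [AddCommGroup M] [TopologicalSpace M] [DiscreteTopology M]

/-- The comparison morphism `P_M → (U ↦ C(U, M))` of Milne II 2.18 (a) on `X_ét`, with both sides
lifted to `Ab.{u+1}` (`m ↦` constant map `m`). [cite: Milne2025, II Examples 2.18 (a)] -/
def constToContinuousMapEtSheafULift :
    (Functor.const (X.Etale)ᵒᵖ).obj (AddCommGrpCat.of (ULift.{u + 1} M)) ⟶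
      ((sheafCompose X.smallEtaleTopology AddCommGrpCat.uliftFunctor.{u + 1}).obj
        (continuousMapEtSheaf X M)).obj where
  app U := AddCommGrpCat.ofHom
    { toFun := fun m => ULift.up (ContinuousMap.const _ m.down)
      map_zero' := rfl
      map_add' := fun _ _ => rfl }
  naturality U V f := by
    ext m
    rfl

/-- `constToContinuousMapEtSheafULift` is locally injective (as for `constToContinuousMapEtSheaf`).
[cite: Milne2025, II Examples 2.18 (a)] -/
theorem isLocallyInjective_constToContinuousMapEtSheafULift :
    Presheaf.IsLocallyInjective X.smallEtaleTopology (constToContinuousMapEtSheafULift X M) where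
  equalizerSieve_mem {U} x y h := by
    by_cases hU : Nonempty U.unop.left
    · obtain ⟨p⟩ := hU
      have hxy : x = y :=
        ULift.ext x y (congrArg (fun s : ULift.{u + 1} C(U.unop.left, M) => s.down p) h)
      subst hxy
      have : Presheaf.equalizerSieve x x = ⊤ := by ext V f; simp
      rw [this]
      exact GrothendieckTopology.top_mem _ _
    · rw [not_nonempty_iff] at hU
      exact GrothendieckTopology.superset_covering _ bot_le (bot_mem_smallEtaleTopology U.unop)

/-- `constToContinuousMapEtSheafULift` is locally surjective (as for `constToContinuousMapEtSheaf`: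
fibres of a continuous map to the discrete `M` form an étale cover on which it is constant).
[cite: Milne2025, II Examples 2.18 (a)] -/
theorem isLocallySurjective_constToContinuousMapEtSheafULift :
    Presheaf.IsLocallySurjective X.smallEtaleTopology (constToContinuousMapEtSheafULift X M) where
  imageSieve_mem {U} s := by
    refine GrothendieckTopology.superset_covering _ ?_
      (ofArrows_etOfOpensι_mem U (fibreOpens (ULift.down s : C(U.left, M))) fun x => ⟨_, rfl⟩)
    rw [Sieve.ofArrows, Sieve.generate_le_iff]
    rintro _ _ ⟨m⟩
    refine ⟨ULift.up m, ?_⟩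
    apply ULift.ext
    refine ContinuousMap.ext ?_
    rintro ⟨p, hp⟩
    exact hp.symm

/-- Hence `constToContinuousMapEtSheafULift` becomes an isomorphism after sheafification
(`smallEtaleTopology` satisfies `WEqualsLocallyBijective` for `Ab.{u+1}` as well).
[cite: Milne2025, II Examples 2.18 (a)] -/
theorem W_constToContinuousMapEtSheafULift :
    X.smallEtaleTopology.W (constToContinuousMapEtSheafULift X M) :=
  haveI := isLocallyInjective_constToContinuousMapEtSheafULift X M
  haveI := isLocallySurjective_constToContinuousMapEtSheafULift X M
  GrothendieckTopology.W_of_isLocallyBijective _ _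

/-- The sheafification of `constToContinuousMapEtSheafULift`, an isomorphism.
[cite: Milne2025, II Examples 2.18 (a)] -/
def sheafifyConstToContinuousMapEtSheafULiftIso :
    (presheafToSheaf X.smallEtaleTopology Ab.{u + 1}).obj
        ((Functor.const (X.Etale)ᵒᵖ).obj (AddCommGrpCat.of (ULift.{u + 1} M))) ≅
      (presheafToSheaf X.smallEtaleTopology Ab.{u + 1}).obj
        ((sheafCompose X.smallEtaleTopology AddCommGrpCat.uliftFunctor.{u + 1}).obj
          (continuousMapEtSheaf X M)).obj :=
  letI : IsIso ((presheafToSheaf X.smallEtaleTopology Ab.{u + 1}).map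
      (constToContinuousMapEtSheafULift X M)) :=
    (GrothendieckTopology.W_iff _ _).1 (W_constToContinuousMapEtSheafULift X M)
  asIso ((presheafToSheaf X.smallEtaleTopology Ab.{u + 1}).map
    (constToContinuousMapEtSheafULift X M))

/-- **Milne II 2.18 (a) with `Ab.{u+1}` coefficients**: the constant étale sheaf with value
`ULift.{u+1} M` is the sheaf `U ↦ C(U, M)` lifted to `Ab.{u+1}`, for `M` discrete.
[cite: Milne2025, II Examples 2.18 (a)] -/
def constantSheafULiftIsoContinuousMapEtSheaf :
    (constantSheaf X.smallEtaleTopology Ab.{u + 1}).obj (AddCommGrpCat.of (ULift.{u + 1} M)) ≅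
      (sheafCompose X.smallEtaleTopology AddCommGrpCat.uliftFunctor.{u + 1}).obj
        (continuousMapEtSheaf X M) :=
  sheafifyConstToContinuousMapEtSheafULiftIso X M ≪≫ (sheafificationIso _).symm

end ConstantULift

/-! ### Bhatt–Scholze Cor. 5.1.6 as a named fact, and the reductions -/

/-- **Bhatt–Scholze Cor. 5.1.6 — étale cohomology is pro-étale cohomology of the pulled-back
sheaf** (named fact, statement only). "For any `K ∈ D⁺(X_ét)`, the adjunction map `K → ν_* ν* K`
is an equivalence", whence `RΓ(X_ét, K) ≃ RΓ(X_ét, ν_*ν*K) = RΓ(X_proét, ν*K)` and, on cohomology,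
`Hⁱ(X_ét, F) ≅ Hⁱ(X_proét, ν*F)` for every abelian sheaf `F` on `X_ét` and every `i ≥ 0`
(equivalently, with Cor. 5.1.9, `Extⁱ(ℤ, F) ≅ Extⁱ(ν*ℤ, ν*F) = Extⁱ(ℤ, ν*F)`, `ν*ℤ = ℤ` by
`pullbackConstantSheafIso`). Printed proof: reduce to `F ∈ Ab(X_ét)`; `H⁰` by Lemma 5.1.2; then
"it suffices to prove `Hᵖ(U, ν*I) = 0` for `I ∈ Ab(X_ét)` injective, `p > 0`, `U ∈ X_proét^{aff}`",
which is a Čech computation over cofiltered limits of affine étale covers (Thm. 2.3.4,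
Lemma 5.1.1) using that filtered colimits are exact. Read on Mathlib's carriers: `F` is an
`Ab.{u}`-valued sheaf on `X.Etale` with `Hⁱ(X_ét, F) = Sheaf.H F i ∈ Type u` (`HasExt.{u}` via the
affine étale site), `ν* = etaleToProetPullback X` is applied to `F` lifted to `Ab.{u+1}`
(`sheafCompose _ uliftFunctor`, the coefficient convention of `Scheme.EllAdicCohomology` on the
cut-off-free `X.ProEt`, Remark 4.1.2), and `Hⁱ(X_proét, ν*F) ∈ Type (u+1)`; the printed statement
does not see coefficient universes, and only the existence of an additive isomorphism is
recorded. The sole remaining input of the comparison side of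
`finite_proetCohomology_zmod_of_isProper` (`finite_proetCohomology_zmod_of_isProper_of_pullback`).
[cite: BhattScholze2015, Cor. 5.1.6] -/
def nonempty_addEquiv_sheafH_etaleToProetPullback : Prop :=
  ∀ (X : Scheme.{u}) (F : Sheaf X.smallEtaleTopology Ab.{u}) (i : ℕ),
    Nonempty ((F.H i : Type u) ≃+
      ((etaleToProetPullback X).obj
        ((sheafCompose X.smallEtaleTopology AddCommGrpCat.uliftFunctor.{u + 1}).obj F)).H i)

/-- **Bhatt–Scholze Cor. 5.1.9 / Cor. 5.1.6 for constant sheaves, from Cor. 5.1.6 — pro-étale and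
étale cohomology of a constant sheaf agree**: for every scheme `X`, every abelian group `M` and every
`i ≥ 0`, `Hⁱ(X_proét, M_X) ≃+ Hⁱ(X_ét, M_X)`, where `M_X` is the constant sheaf with value `M` on the
respective small site and `Hⁱ = Extⁱ(ℤ, –)` (Mathlib `Sheaf.H`; Milne III 1.5 (a), 1.6 (e)). Printed
source: "The pullback `ν* : Ab(X_ét) → Ab(X_proét)` induces an equivalence on `Extⁱ` for all `i`"
(Cor. 5.1.9, from Cor. 5.1.6: `K ≃ Rν_*ν*K` for `K ∈ D⁺(X_ét)`), applied to the pair `(ℤ_X, M_X)`,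
together with `ν* ∘ const_ét ≅ const_proét` (`pullbackConstantSheafIso`). Read on Mathlib's
carriers: `X.ProEt` without cardinal cut-off (Remark 4.1.2) with coefficients `ULift M ∈ Ab.{u+1}`
(the convention of `Scheme.EllAdicCohomology`, left side in `Type (u+1)`), `X.Etale` with
coefficients `ULift M ∈ Ab.{u}` (the convention of `finite_etaleCohomology_of_isProper`, right side
in `Type u`); only the existence of an additive isomorphism is recorded. The conclusion is stated
explicitly and is *not* vendored as a separate named fact: it is Cor. 5.1.6 specialised to constant
sheaves — the bridge fact `nonempty_addEquiv_proetCohomology_etaleCohomology` reworded once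
Lemma 4.2.12 is proved — and has no proof obligation of its own (D-0026). Real proof of the
implication from `nonempty_addEquiv_sheafH_etaleToProetPullback`:
`M_X^{proét} ≅ ν*(M_X^{ét})` (`pullbackConstantSheafIso`), `M_X^{ét} ≅ (U ↦ C(U, M))` lifted to
`Ab.{u+1}` for the discrete topology on `M` (`constantSheafULiftIsoContinuousMapEtSheaf`,
Milne II 2.18 (a)), Cor. 5.1.6 for the `Ab.{u}`-valued sheaf `U ↦ C(U, M)`, and Milne II 2.18 (a)
again in `Ab.{u}` (`etaleCohomologyConstEquivContinuousMapH`); cohomology is transported along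
isomorphisms of sheaves by `addEquivHOfIso`.
[cite: BhattScholze2015, Cor. 5.1.6 and Cor. 5.1.9] [cite: Milne2025, II Examples 2.18 (a)] -/
theorem nonempty_addEquiv_constantSheafH_proet_etale_of_pullback
    (h : nonempty_addEquiv_sheafH_etaleToProetPullback.{u}) (X : Scheme.{u}) (M : Type)
    [AddCommGroup M] (i : ℕ) :
    Nonempty
      (((constantSheaf (Scheme.ProEt.topology X) Ab.{u + 1}).obj
          (AddCommGrpCat.of (ULift.{u + 1} M))).H i ≃+
        (((constantSheaf X.smallEtaleTopology Ab.{u}).obj (AddCommGrpCat.of (ULift.{u} M))).H i :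
          Type u)) := by
  letI : TopologicalSpace M := ⊥
  haveI : DiscreteTopology M := ⟨rfl⟩
  obtain ⟨e⟩ := h X (continuousMapEtSheaf X M) i
  -- `M_X^{proét} ≅ ν*(M_X^{ét}) ≅ ν*(ulift (U ↦ C(U, M)))`
  let e₁ : (constantSheaf (Scheme.ProEt.topology X) Ab.{u + 1}).obj
        (AddCommGrpCat.of (ULift.{u + 1} M)) ≅
      (etaleToProetPullback X).obj
        ((sheafCompose X.smallEtaleTopology AddCommGrpCat.uliftFunctor.{u + 1}).obj
          (continuousMapEtSheaf X M)) :=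
    ((pullbackConstantSheafIso X).symm.app (AddCommGrpCat.of (ULift.{u + 1} M))) ≪≫
      (etaleToProetPullback X).mapIso (constantSheafULiftIsoContinuousMapEtSheaf X M)
  exact ⟨((addEquivHOfIso e₁ i).trans e.symm).trans
    (etaleCohomologyConstEquivContinuousMapH X M i).symm⟩

/-- **`Hⁱ(X_proét, F_M) ≃+ Hⁱ(X_ét, M_X)` for every discrete abelian group `M`, from Cor. 5.1.6**:
compose the proved Lemma 4.2.12 transport `Hⁱ(X_proét, F_M) ≃+ Hⁱ(X_proét, M_X)`
(`proetCohomologyEquivConstantSheafH`) with the constant-sheaf comparison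
(`nonempty_addEquiv_constantSheafH_proet_etale_of_pullback`).
[cite: BhattScholze2015, Cor. 5.1.6 and Lemma 4.2.12] -/
theorem nonempty_addEquiv_proetCohomology_of_pullback
    (h : nonempty_addEquiv_sheafH_etaleToProetPullback.{u}) (X : Scheme.{u}) (M : Type)
    [AddCommGroup M] [TopologicalSpace M] [DiscreteTopology M] (i : ℕ) :
    Nonempty (ProetCohomology X M i ≃+
      (((constantSheaf X.smallEtaleTopology Ab.{u}).obj (AddCommGrpCat.of (ULift.{u} M))).H i :
        Type u)) := by
  obtain ⟨e⟩ := nonempty_addEquiv_constantSheafH_proet_etale_of_pullback h X M i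
  exact ⟨(proetCohomologyEquivConstantSheafH X M i).trans e⟩

/-- **The bridge fact `nonempty_addEquiv_proetCohomology_etaleCohomology` from Cor. 5.1.6** (the case
`M = ℤ/n`, discrete, of `nonempty_addEquiv_proetCohomology_of_pullback`).
[cite: BhattScholze2015, Cor. 5.1.6] -/
theorem nonempty_addEquiv_proetCohomology_etaleCohomology_of_pullback
    (h : nonempty_addEquiv_sheafH_etaleToProetPullback.{u}) :
    nonempty_addEquiv_proetCohomology_etaleCohomology.{u} :=
  fun X n i => nonempty_addEquiv_proetCohomology_of_pullback h X (ZMod n) i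

/-- **`finite_proetCohomology_zmod_of_isProper` from Milne VI Cor. 2.8 on the étale site and
Bhatt–Scholze Cor. 5.1.6** — the current trust base of the pro-étale finiteness fact:
{`finite_etaleCohomology_of_isProper`, `nonempty_addEquiv_sheafH_etaleToProetPullback`}; the
morphism of sites, `ν* ∘ const = const`, and the identification of constant sheaves with sheaves
of locally constant maps on both sites are proved.
[cite: Milne2025, VI Cor. 2.8] [cite: BhattScholze2015, Cor. 5.1.6] -/
theorem finite_proetCohomology_zmod_of_isProper_of_pullback
    (h₂ : finite_etaleCohomology_of_isProper.{u})
    (h : nonempty_addEquiv_sheafH_etaleToProetPullback.{u}) :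
    finite_proetCohomology_zmod_of_isProper.{u} :=
  finite_proetCohomology_zmod_of_isProper_of_etale_facts h₂
    (nonempty_addEquiv_proetCohomology_etaleCohomology_of_pullback h)

end Literature.AlgebraicGeometry.Motives

end
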